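import Summits.Ventures.PercRepro.ProfileBiIndepLevels

/-!
# PercRepro — THE TOP-BUT-ONE LEVEL ONE STEP BEYOND THE MINIMAL GROUND SET (`#E = ρ + q + 1`) IN CLOSED FORM:
TWO «UNICYCLIC LYM» INEQUALITIES (p10, gen 9; `proofs/P10-AVFULL.md` §18(j))

Call `X ⊆ E` UNICYCLIC when `ρ(X) + 1 = #X` (a unique circuit), and put
`U_k := #{X : #X = k, X unicyclic, E ∖ X independent}` (`uniIndepSets`), `P_k` the bi-independent counts of
ProfileBiIndepDensity.  On `#E = ρ(E) + q + 1` the closed form `profileIneqMinusQ_top_but_one_iff` of the row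
`(q, ρ−1)` has no bi-independent set on its left side at all:

  `Π⁻_{q,ρ−1}(M)  ⟺  ρ·(U_{ρ+1} + U_{q+1}) ≤ (q+1)·(P_{ρ−1} + U_ρ + U_{q+2})`          (`profileIneqMinusQ_iff_unicyclic`)

— the rank-`q` sets with spanning complement are the independent `q`-sets whose complement is a spanning
unicyclic `(ρ+1)`-set (`U_{ρ+1}`, by complement) and the unicyclic `(q+1)`-sets whose complement is a basis
(`U_{q+1}`); the rank-`(ρ−1)` sets of co-rank `≥ q+1` are the bi-independent `(ρ−1)`-sets (`P_{ρ−1}`), the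
independent `(ρ−1)`-sets whose complement is a unicyclic `(q+2)`-set (`U_{q+2}`, by complement) and the
unicyclic `ρ`-sets with independent complement (`U_ρ`).  DATA (P10-AVFULL.md §18(j)): the two halves
`ρ·U_{ρ+1} ≤ (q+1)·(P_{ρ−1} + U_ρ)` and `ρ·U_{q+1} ≤ (q+1)·U_{q+2}` hold separately on every matroid on
`≤ 9` elements with `#E = ρ+q+1` (0 / 191,576 at `n = 9`); neither is proved; nothing here asserts them.

* `uniIndepSets`, `mem_uniIndepSets`;
* `filter_Rq_top_eq`, `card_filter_Rq_top_of_card_eq` (the left side);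
* `card_filter_levelSetCoQ_of_card_eq` (the right side);
* **`profileIneqMinusQ_iff_unicyclic`**.
-/

open scoped Matroid

namespace PercRepro.Cogirth

open Finset ThmH Skew Shadow Profile

variable {α : Type} [DecidableEq α] {M : Matroid α} [M.Finite]

/-- The unicyclic `k`-subsets of the ground set whose complement is independent: `ρ(X) + 1 = #X`. -/
noncomputable def uniIndepSets (M : Matroid α) [M.Finite] (k : ℕ) : Finset (Finset α) :=
  (gr M).powerset.filter (fun X => X.card = k ∧ rk M X + 1 = X.card ∧ rk M (gr M \ X) = (gr M \ X).card)

/-- Membership in `uniIndepSets`. -/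
theorem mem_uniIndepSets {k : ℕ} {X : Finset α} :
    X ∈ uniIndepSets M k ↔
      X ⊆ gr M ∧ X.card = k ∧ rk M X + 1 = X.card ∧ rk M (gr M \ X) = (gr M \ X).card := by
  unfold uniIndepSets
  rw [mem_filter, mem_powerset]

/-! ### The left side: rank-`q` sets with spanning complement on `#E = ρ + q + 1` -/

/-- The rank-`q` sets with spanning complement and `q + 1` elements are the unicyclic `(q+1)`-sets with a basis as
complement. -/
theorem filter_Rq_top_card_succ {q : ℕ} (hn : (gr M).card = rk M (gr M) + q + 1) :
    ((Rq M q).filter (fun B => rk M (gr M \ B) = rk M (gr M))).filter (fun B => B.card = q + 1) =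
      uniIndepSets M (q + 1) := by
  ext B
  rw [mem_filter, mem_filter, mem_Rq, mem_uniIndepSets]
  constructor
  · rintro ⟨⟨⟨hBg, hBr⟩, hBc⟩, hBk⟩
    have hrk : rk M B = q := rk_eq_of_eRk_eq hBr
    have h3 := card_sdiff_of_subset hBg
    exact ⟨hBg, hBk, by omega, by omega⟩
  · rintro ⟨hBg, hBk, hBr, hBc⟩
    have h3 := card_sdiff_of_subset hBg
    refine ⟨⟨⟨hBg, ?_⟩, by omega⟩, hBk⟩
    rw [← coe_rk]
    congr 1
    omega

/-- The rank-`q` sets with spanning complement and `q` elements correspond, by complement, to the spanning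
unicyclic `(ρ+1)`-sets with independent complement. -/
theorem card_filter_Rq_top_card_eq {q : ℕ} (hn : (gr M).card = rk M (gr M) + q + 1) :
    (((Rq M q).filter (fun B => rk M (gr M \ B) = rk M (gr M))).filter (fun B => B.card = q)).card =
      (uniIndepSets M (rk M (gr M) + 1)).card := by
  apply card_bij (fun B _ => gr M \ B)
  · intro B hB
    rw [mem_filter, mem_filter, mem_Rq] at hB
    obtain ⟨⟨⟨hBg, hBr⟩, hBc⟩, hBk⟩ := hB
    have hrk : rk M B = q := rk_eq_of_eRk_eq hBr
    have h3 := card_sdiff_of_subset hBg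
    rw [mem_uniIndepSets]
    refine ⟨sdiff_subset, by omega, by omega, ?_⟩
    rw [Finset.sdiff_sdiff_eq_self hBg]
    omega
  · intro B₁ hB₁ B₂ hB₂ h
    have h₁ : B₁ ⊆ gr M := (mem_Rq.1 (mem_filter.1 (mem_filter.1 hB₁).1).1).1
    have h₂ : B₂ ⊆ gr M := (mem_Rq.1 (mem_filter.1 (mem_filter.1 hB₂).1).1).1
    rw [← Finset.sdiff_sdiff_eq_self h₁, ← Finset.sdiff_sdiff_eq_self h₂, h]
  · intro X hX
    rw [mem_uniIndepSets] at hX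
    obtain ⟨hXg, hXk, hXr, hXc⟩ := hX
    refine ⟨gr M \ X, ?_, Finset.sdiff_sdiff_eq_self hXg⟩
    have h3 := card_sdiff_of_subset hXg
    rw [mem_filter, mem_filter, mem_Rq, Finset.sdiff_sdiff_eq_self hXg]
    refine ⟨⟨⟨sdiff_subset, ?_⟩, by omega⟩, by omega⟩
    rw [← coe_rk]
    congr 1
    omega

/-- The left side of the closed form on `#E = ρ + q + 1`: `U_{ρ+1} + U_{q+1}`. -/
theorem card_filter_Rq_top_of_card_eq {q : ℕ} (hn : (gr M).card = rk M (gr M) + q + 1) :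
    ((Rq M q).filter (fun B => rk M (gr M \ B) = rk M (gr M))).card =
      (uniIndepSets M (rk M (gr M) + 1)).card + (uniIndepSets M (q + 1)).card := by
  have hsplit := Finset.card_filter_add_card_filter_not
    (s := (Rq M q).filter (fun B => rk M (gr M \ B) = rk M (gr M))) (fun B => B.card = q)
  have hnot : ((Rq M q).filter (fun B => rk M (gr M \ B) = rk M (gr M))).filter (fun B => ¬ B.card = q) =
      ((Rq M q).filter (fun B => rk M (gr M \ B) = rk M (gr M))).filter (fun B => B.card = q + 1) := by
    apply filter_congr
    intro B hB
    rw [mem_filter, mem_Rq] at hB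
    obtain ⟨⟨hBg, hBr⟩, hBc⟩ := hB
    have hrk : rk M B = q := rk_eq_of_eRk_eq hBr
    have h1 := rk_le_card (M := M) B
    have h2 := rk_le_card (M := M) (gr M \ B)
    have h3 := card_sdiff_of_subset hBg
    have h4 := card_le_card hBg
    constructor <;> intro h <;> omega
  rw [← hsplit, hnot, card_filter_Rq_top_card_eq hn, filter_Rq_top_card_succ hn]

/-! ### The right side: rank-`(ρ−1)` sets of co-rank `≥ q + 1` on `#E = ρ + q + 1` -/

/-- Those with `ρ` elements are the unicyclic `ρ`-sets with independent complement. -/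
theorem filter_levelSetCoQ_card_rk {q : ℕ} (hn : (gr M).card = rk M (gr M) + q + 1)
    (hq : q + 2 ≤ rk M (gr M)) :
    ((levelSetCoQ M q (rk M (gr M) - 1)).filter (fun S => q + 1 ≤ rk M (gr M \ S))).filter
        (fun S => S.card = rk M (gr M)) = uniIndepSets M (rk M (gr M)) := by
  ext S
  rw [mem_filter, mem_filter, mem_levelSetCoQ, mem_uniIndepSets]
  constructor
  · rintro ⟨⟨⟨⟨hSg, hSr⟩, _⟩, hSc⟩, hSk⟩
    have hrk : rk M S = rk M (gr M) - 1 := rk_eq_of_eRk_eq hSr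
    have h2 := rk_le_card (M := M) (gr M \ S)
    have h3 := card_sdiff_of_subset hSg
    have h4 := card_le_card hSg
    refine ⟨hSg, hSk, by omega, by omega⟩
  · rintro ⟨hSg, hSk, hSr, hSc⟩
    have h3 := card_sdiff_of_subset hSg
    have h4 := card_le_card hSg
    refine ⟨⟨⟨⟨hSg, ?_⟩, by omega⟩, by omega⟩, hSk⟩
    rw [← coe_rk]
    congr 1
    omega

/-- Those with `ρ − 1` elements and co-rank `q + 2` are the bi-independent `(ρ−1)`-sets. -/
theorem filter_levelSetCoQ_card_pred_bi {q : ℕ} (hn : (gr M).card = rk M (gr M) + q + 1)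
    (hq : q + 2 ≤ rk M (gr M)) :
    (((levelSetCoQ M q (rk M (gr M) - 1)).filter (fun S => q + 1 ≤ rk M (gr M \ S))).filter
        (fun S => ¬ S.card = rk M (gr M))).filter (fun S => rk M (gr M \ S) = q + 2) =
      biIndepSets M (rk M (gr M) - 1) := by
  ext S
  rw [mem_filter, mem_filter, mem_filter, mem_levelSetCoQ, mem_biIndepSets]
  constructor
  · rintro ⟨⟨⟨⟨⟨hSg, hSr⟩, _⟩, hSc⟩, hSk⟩, hSc2⟩
    have hrk : rk M S = rk M (gr M) - 1 := rk_eq_of_eRk_eq hSr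
    have h1 := rk_le_card (M := M) S
    have h2 := rk_le_card (M := M) (gr M \ S)
    have h3 := card_sdiff_of_subset hSg
    have h4 := card_le_card hSg
    refine ⟨hSg, by omega, by omega, by omega⟩
  · rintro ⟨hSg, hSk, hSr, hSc⟩
    have h3 := card_sdiff_of_subset hSg
    have h4 := card_le_card hSg
    refine ⟨⟨⟨⟨⟨hSg, ?_⟩, by omega⟩, by omega⟩, by omega⟩, by omega⟩
    rw [← coe_rk, hSr, hSk]

/-- Those with `ρ − 1` elements and co-rank `q + 1` correspond, by complement, to the unicyclic `(q+2)`-sets with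
independent complement. -/
theorem card_filter_levelSetCoQ_card_pred_uni {q : ℕ} (hn : (gr M).card = rk M (gr M) + q + 1)
    (hq : q + 2 ≤ rk M (gr M)) :
    ((((levelSetCoQ M q (rk M (gr M) - 1)).filter (fun S => q + 1 ≤ rk M (gr M \ S))).filter
        (fun S => ¬ S.card = rk M (gr M))).filter (fun S => ¬ rk M (gr M \ S) = q + 2)).card =
      (uniIndepSets M (q + 2)).card := by
  apply card_bij (fun S _ => gr M \ S)
  · intro S hS
    rw [mem_filter, mem_filter, mem_filter, mem_levelSetCoQ] at hS
    obtain ⟨⟨⟨⟨⟨hSg, hSr⟩, _⟩, hSc⟩, hSk⟩, hSc2⟩ := hS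
    have hrk : rk M S = rk M (gr M) - 1 := rk_eq_of_eRk_eq hSr
    have h1 := rk_le_card (M := M) S
    have h2 := rk_le_card (M := M) (gr M \ S)
    have h3 := card_sdiff_of_subset hSg
    have h4 := card_le_card hSg
    rw [mem_uniIndepSets, Finset.sdiff_sdiff_eq_self hSg]
    exact ⟨sdiff_subset, by omega, by omega, by omega⟩
  · intro S₁ hS₁ S₂ hS₂ h
    have h₁ : S₁ ⊆ gr M :=
      (mem_levelSetCoQ.1 (mem_filter.1 (mem_filter.1 (mem_filter.1 hS₁).1).1).1).1.1
    have h₂ : S₂ ⊆ gr M :=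
      (mem_levelSetCoQ.1 (mem_filter.1 (mem_filter.1 (mem_filter.1 hS₂).1).1).1).1.1
    rw [← Finset.sdiff_sdiff_eq_self h₁, ← Finset.sdiff_sdiff_eq_self h₂, h]
  · intro X hX
    rw [mem_uniIndepSets] at hX
    obtain ⟨hXg, hXk, hXr, hXc⟩ := hX
    refine ⟨gr M \ X, ?_, Finset.sdiff_sdiff_eq_self hXg⟩
    have h3 := card_sdiff_of_subset hXg
    have h4 := card_le_card hXg
    rw [mem_filter, mem_filter, mem_filter, mem_levelSetCoQ, Finset.sdiff_sdiff_eq_self hXg]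
    refine ⟨⟨⟨⟨⟨sdiff_subset, ?_⟩, by omega⟩, by omega⟩, by omega⟩, by omega⟩
    rw [← coe_rk]
    congr 1
    omega

/-- The right side of the closed form on `#E = ρ + q + 1`: `P_{ρ−1} + U_ρ + U_{q+2}`. -/
theorem card_filter_levelSetCoQ_of_card_eq {q : ℕ} (hn : (gr M).card = rk M (gr M) + q + 1)
    (hq : q + 2 ≤ rk M (gr M)) :
    ((levelSetCoQ M q (rk M (gr M) - 1)).filter (fun S => q + 1 ≤ rk M (gr M \ S))).card =
      (biIndepSets M (rk M (gr M) - 1)).card + (uniIndepSets M (rk M (gr M))).card +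
        (uniIndepSets M (q + 2)).card := by
  set F := (levelSetCoQ M q (rk M (gr M) - 1)).filter (fun S => q + 1 ≤ rk M (gr M \ S)) with hF
  have h1 := Finset.card_filter_add_card_filter_not (s := F) (fun S => S.card = rk M (gr M))
  have h2 := Finset.card_filter_add_card_filter_not (s := F.filter (fun S => ¬ S.card = rk M (gr M)))
    (fun S => rk M (gr M \ S) = q + 2)
  rw [← h1, ← h2, hF, filter_levelSetCoQ_card_rk hn hq, filter_levelSetCoQ_card_pred_bi hn hq,
    card_filter_levelSetCoQ_card_pred_uni hn hq]
  ring

/-! ### The closed form -/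

/-- **THE TOP-BUT-ONE LEVEL ON `#E = ρ + q + 1` IN UNICYCLIC FORM**:
`Π⁻_{q,ρ−1}(M) ⟺ ρ·(U_{ρ+1} + U_{q+1}) ≤ (q+1)·(P_{ρ−1} + U_ρ + U_{q+2})`. -/
theorem profileIneqMinusQ_iff_unicyclic {q : ℕ} (hn : (gr M).card = rk M (gr M) + q + 1)
    (hq : q + 2 ≤ rk M (gr M)) :
    ProfileIneqMinusQ M q (rk M (gr M) - 1) ↔
      rk M (gr M) * ((uniIndepSets M (rk M (gr M) + 1)).card + (uniIndepSets M (q + 1)).card) ≤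
        (q + 1) * ((biIndepSets M (rk M (gr M) - 1)).card + (uniIndepSets M (rk M (gr M))).card +
          (uniIndepSets M (q + 2)).card) := by
  have hu : rk M (gr M) - 1 + 1 = rk M (gr M) := by omega
  rw [profileIneqMinusQ_top_but_one_iff (by omega) hu]
  have e1 : (Rq M q).filter (fun B => rk M (gr M \ B) = rk M (gr M) - 1 + 1) =
      (Rq M q).filter (fun B => rk M (gr M \ B) = rk M (gr M)) := by rw [hu]
  rw [e1, card_filter_Rq_top_of_card_eq hn, card_filter_levelSetCoQ_of_card_eq hn hq, hu]
  -- C(ρ, q+1) · a ≤ C(ρ−1, q) · b  ⟺  ρ · a ≤ (q+1) · b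
  generalize rk M (gr M) = ρ at *
  generalize (uniIndepSets M (ρ + 1)).card + (uniIndepSets M (q + 1)).card = a
  generalize (biIndepSets M (ρ - 1)).card + (uniIndepSets M ρ).card + (uniIndepSets M (q + 2)).card = b
  have hid : ρ * (ρ - 1).choose q = ρ.choose (q + 1) * (q + 1) := by
    have := Nat.add_one_mul_choose_eq (ρ - 1) q
    rwa [show ρ - 1 + 1 = ρ by omega] at this
  have hpos1 : 0 < (ρ - 1).choose q := Nat.choose_pos (by omega)
  constructor
  · intro h
    refine Nat.le_of_mul_le_mul_left ?_ hpos1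
    calc (ρ - 1).choose q * (ρ * a) = (ρ * (ρ - 1).choose q) * a := by ring
      _ = (ρ.choose (q + 1) * (q + 1)) * a := by rw [hid]
      _ = (q + 1) * (ρ.choose (q + 1) * a) := by ring
      _ ≤ (q + 1) * ((ρ - 1).choose q * b) := Nat.mul_le_mul_left _ h
      _ = (ρ - 1).choose q * ((q + 1) * b) := by ring
  · intro h
    refine Nat.le_of_mul_le_mul_left ?_ (show 0 < q + 1 by omega)
    calc (q + 1) * (ρ.choose (q + 1) * a) = (ρ.choose (q + 1) * (q + 1)) * a := by ring
      _ = (ρ * (ρ - 1).choose q) * a := by rw [hid]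
      _ = (ρ - 1).choose q * (ρ * a) := by ring
      _ ≤ (ρ - 1).choose q * ((q + 1) * b) := Nat.mul_le_mul_left _ h
      _ = (q + 1) * ((ρ - 1).choose q * b) := by ring

end PercRepro.Cogirth
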